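import Summits.RiemannHypothesis.RiemannHypothesis.Theorems.WeilFormatCDeflatedFarDoorEven
import Summits.RiemannHypothesis.RiemannHypothesis.Theorems.WeilFormatCDeflatedFarDoorOdd
import HarnessLib

/-!
# Format C, design C∞: `WeilPositivityOn a` from a deflated certificate with LIMIT data (the C∞ front door)

Route context: Fourier–Galerkin / Schur-complement certificates of Weil positivity on a window ("format C";
cell memo `run/shared/lean/pub/rh-explicit/rh-explicit-weil-10/KERNEL-LEVER.md` §17–§19; supporting
stmt-RiemannHypothesis-0098; seat rh-explicit-weil-10).  A rung `WeilPositivityOn a` is one case of the tree's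
`riemannHypothesis_iff_forall_weilPositivityOn`; this file is the FRONT DOOR of design C∞ (hybrid basis: Fourier block ⊕
window-polynomial profiles, far Fourier modes deflated by the profiles; KERNEL-LEVER §4): the two sector certificates
`evenKernel_nonneg_of_certificate_cinf` / `oddKernel_nonneg_of_certificate_cinf` combined by
`weilPositivityOn_of_sector_kernels_nonneg`.  Hypotheses: `a > 0`; per sector the block size, the profiles
(`C³`, even resp. odd, real-valued, `C¹`-periodising boundary data), and DATA — a far diagonal `d̂ ≥ d₀ > 0` with its far
inequality for the sector kernel (dischargeable by `gramCoeff_even_far_ge_diag_A` / `gramCoeff_odd_far_ge_diag_atan_A`), a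
free map `Λ` with `Σ_j|Λ_j| ≤ λ(Σ|x_i| + Σ|β_j|)`, a majorant `Uq` of the LIMIT coupling for every truncation, and one
kernel inequality with margin `δ > 0` in the limit objects (closed-form window entries `Re/Im W_a(·,·)` and the series
`E∞, A∞, ρ∞, σ∞` with the tails of `WeilFormatCDeflatedFarSectorDecay` / `WeilFormatCDeflatedFarEntryLimits`).

* `weilPositivityOn_of_formatC_cinf`.

Standard axioms; no definitions; no RH claim beyond the stated case.
-/

set_option autoImplicit false
-- `Summit.RiemannHypothesis.RiemannHypothesis.…` is the layout-mandated namespace (summit = problem name).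
set_option linter.dupNamespace false

noncomputable section

open Complex Filter Set MeasureTheory Finset
open scoped Real Topology ComplexConjugate

namespace Summit.RiemannHypothesis.RiemannHypothesis.Theorems.WeilFormatC

open Literature.NumberTheory.LFunctions Literature.NumberTheory.LFunctions.Yoshida1992

variable {a : ℝ}

/-- **Weil positivity on `[−a, a]` from a C∞ (deflated, limit-data) format-C certificate.**  Both sector certificates
(`evenKernel_nonneg_of_certificate_cinf`, `oddKernel_nonneg_of_certificate_cinf`) assembled by
`weilPositivityOn_of_sector_kernels_nonneg`: every analytic hypothesis is discharged in the tree; the remaining hypotheses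
are the profiles' admissibility and, per sector, DATA — a far diagonal with floor and far inequality, a free map with an
`ℓ¹` bound, a majorant of the limit coupling, and one kernel inequality with a margin. -/
theorem weilPositivityOn_of_formatC_cinf (ha : 0 < a)
    -- EVEN sector
    (Be : ℕ) {re : ℕ} (fe : Fin re → ℝ → ℂ)
    (hfeC : ∀ j, ContDiff ℝ 3 (fe j)) (hfee : ∀ j x, fe j (-x) = fe j x) (hfer : ∀ j x, conj (fe j x) = fe j x)
    (hfe1 : ∀ j, deriv (fe j) (-a) = deriv (fe j) a)
    -- DATA: far diagonal with floor and far inequality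
    (de : ℕ → ℝ) {d₀e : ℝ} (hde₀ : 0 < d₀e) (hde : ∀ m, Be + 1 ≤ m → d₀e ≤ de m)
    (hfare : ∀ (N : ℕ) (y : ℕ → ℝ),
      ∑ n ∈ Finset.Ico (Be + 1) N, de n * y n ^ 2 ≤ ∑ n ∈ Finset.Ico (Be + 1) N, ∑ m ∈ Finset.Ico (Be + 1) N,
        y n * (if n = 0 then gramCoeff a 0 m else if m = 0 then gramCoeff a n 0
          else (gramCoeff a n m + gramCoeff a n (-(m : ℤ))) / 2) * y m)
    -- DATA: free map, coupling majorant, margin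
    (Λe : (Fin (Be + 1) → ℝ) → (Fin re → ℝ) → Fin re → ℝ) {lame : ℝ} (hlame : 0 ≤ lame)
    (hΛe : ∀ (x : Fin (Be + 1) → ℝ) (β : Fin re → ℝ), ∑ j, |Λe x β j| ≤ lame * (∑ i, |x i| + ∑ j, |β j|))
    (Uqe : (Fin (Be + 1) → ℝ) → (Fin re → ℝ) → ℝ)
    (hUqe : ∀ (N : ℕ) (x : Fin (Be + 1) → ℝ) (β : Fin re → ℝ),
      ∑ m ∈ Finset.Ico (Be + 1) N,
        (∑ i : Fin (Be + 1), (if (i : ℕ) = 0 then gramCoeff a 0 m else if m = 0 then gramCoeff a i 0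
            else (gramCoeff a i m + gramCoeff a i (-(m : ℤ))) / 2) * x i
          + ∑ j, ((weilWindowSesq a ((Icc (-a) a).indicator (fe j) - proj a Be ((Icc (-a) a).indicator (fe j)))
              (chiEven a m)).re / (if m = 0 then 1 else Real.sqrt 2)) * β j) ^ 2 / de m ≤ Uqe x β)
    {δe : ℝ} (hδe : 0 < δe)
    (hSe : ∀ (x : Fin (Be + 1) → ℝ) (β : Fin re → ℝ),
      δe * (∑ i, x i ^ 2 + ∑ j, β j ^ 2) ≤
        ((∑ i : Fin (Be + 1), ∑ i' : Fin (Be + 1), x i * x i' *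
            (if (i : ℕ) = 0 then gramCoeff a 0 i' else if (i' : ℕ) = 0 then gramCoeff a i 0
              else (gramCoeff a i i' + gramCoeff a i (-(i' : ℤ))) / 2))
          + 2 * (∑ i : Fin (Be + 1), ∑ j : Fin re, x i * β j *
            ((weilWindowSesq a ((Icc (-a) a).indicator (fe j) - proj a Be ((Icc (-a) a).indicator (fe j)))
              (chiEven a i)).re / (if (i : ℕ) = 0 then 1 else Real.sqrt 2)))
          + (∑ j : Fin re, ∑ j' : Fin re, β j * β j' *
            (weilWindowSesq a ((Icc (-a) a).indicator (fe j) - proj a Be ((Icc (-a) a).indicator (fe j)))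
              ((Icc (-a) a).indicator (fe j') - proj a Be ((Icc (-a) a).indicator (fe j')))).re))
        - Uqe x β
        + ((2 * ∑ j, Λe x β j *
            ((β j - ∑ j', (∑' n : ℕ, if Be + 1 ≤ n then
                ((if n = 0 then 1 else 2) * (Yoshida1992.fourierCoeff a n ((Icc (-a) a).indicator (fe j))).re /
                  Real.sqrt (2 * a)) *
                ((if n = 0 then 1 else 2) * (Yoshida1992.fourierCoeff a n ((Icc (-a) a).indicator (fe j'))).re /
                  Real.sqrt (2 * a)) else 0) * β j')
            + (∑ i : Fin (Be + 1), (∑' m : ℕ, if Be + 1 ≤ m then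
                ((if m = 0 then 1 else 2) * (Yoshida1992.fourierCoeff a m ((Icc (-a) a).indicator (fe j))).re /
                  Real.sqrt (2 * a)) *
                (if (i : ℕ) = 0 then gramCoeff a 0 m else if m = 0 then gramCoeff a i 0
                  else (gramCoeff a i m + gramCoeff a i (-(m : ℤ))) / 2) / de m else 0) * x i
              + ∑ j'', (∑' m : ℕ, if Be + 1 ≤ m then
                ((if m = 0 then 1 else 2) * (Yoshida1992.fourierCoeff a m ((Icc (-a) a).indicator (fe j))).re /
                  Real.sqrt (2 * a)) *
                ((weilWindowSesq a ((Icc (-a) a).indicator (fe j'') - proj a Be ((Icc (-a) a).indicator (fe j'')))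
                  (chiEven a m)).re / (if m = 0 then 1 else Real.sqrt 2)) / de m else 0) * β j'')))
          - ∑ j, ∑ j', Λe x β j * Λe x β j' *
            (∑' m : ℕ, if Be + 1 ≤ m then
              ((if m = 0 then 1 else 2) * (Yoshida1992.fourierCoeff a m ((Icc (-a) a).indicator (fe j))).re /
                Real.sqrt (2 * a)) *
              ((if m = 0 then 1 else 2) * (Yoshida1992.fourierCoeff a m ((Icc (-a) a).indicator (fe j'))).re /
                Real.sqrt (2 * a)) / de m else 0)))
    -- ODD sector
    {Bo : ℕ} (hBo : 1 ≤ Bo) {ro : ℕ} (fo : Fin ro → ℝ → ℂ)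
    (hfoC : ∀ j, ContDiff ℝ 3 (fo j)) (hfoo : ∀ j x, fo j (-x) = -fo j x) (hfor : ∀ j x, conj (fo j x) = fo j x)
    (hfoa : ∀ j, fo j a = 0) (hfo1 : ∀ j, deriv (fo j) (-a) = deriv (fo j) a)
    -- DATA: far diagonal with floor and far inequality
    (dod : ℕ → ℝ) {d₀o : ℝ} (hdo₀ : 0 < d₀o) (hdo : ∀ m, Bo ≤ m → d₀o ≤ dod m)
    (hfaro : ∀ (N : ℕ) (z : ℕ → ℝ),
      ∑ k ∈ Finset.Ico Bo N, dod k * z k ^ 2 ≤ ∑ k ∈ Finset.Ico Bo N, ∑ l ∈ Finset.Ico Bo N,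
        z k * ((gramCoeff a ((k : ℤ) + 1) ((l : ℤ) + 1) - gramCoeff a ((k : ℤ) + 1) (-((l : ℤ) + 1))) / 2) * z l)
    -- DATA: free map, coupling majorant, margin
    (Λo : (Fin Bo → ℝ) → (Fin ro → ℝ) → Fin ro → ℝ) {lamo : ℝ} (hlamo : 0 ≤ lamo)
    (hΛo : ∀ (x : Fin Bo → ℝ) (β : Fin ro → ℝ), ∑ j, |Λo x β j| ≤ lamo * (∑ i, |x i| + ∑ j, |β j|))
    (Uqo : (Fin Bo → ℝ) → (Fin ro → ℝ) → ℝ)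
    (hUqo : ∀ (N : ℕ) (x : Fin Bo → ℝ) (β : Fin ro → ℝ),
      ∑ m ∈ Finset.Ico Bo N,
        (∑ i : Fin Bo, ((gramCoeff a (((i : ℕ) : ℤ) + 1) ((m : ℤ) + 1) - gramCoeff a (((i : ℕ) : ℤ) + 1) (-((m : ℤ) + 1))) / 2)
            * x i
          + ∑ j, ((weilWindowSesq a ((Icc (-a) a).indicator (fo j) - proj a Bo ((Icc (-a) a).indicator (fo j)))
              (chiOdd a (m + 1))).im / Real.sqrt 2) * β j) ^ 2 / dod m ≤ Uqo x β)
    {δo : ℝ} (hδo : 0 < δo)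
    (hSo : ∀ (x : Fin Bo → ℝ) (β : Fin ro → ℝ),
      δo * (∑ i, x i ^ 2 + ∑ j, β j ^ 2) ≤
        ((∑ i : Fin Bo, ∑ i' : Fin Bo, x i * x i' *
            ((gramCoeff a (((i : ℕ) : ℤ) + 1) (((i' : ℕ) : ℤ) + 1)
              - gramCoeff a (((i : ℕ) : ℤ) + 1) (-((((i' : ℕ) : ℤ)) + 1))) / 2))
          + 2 * (∑ i : Fin Bo, ∑ j : Fin ro, x i * β j *
            ((weilWindowSesq a ((Icc (-a) a).indicator (fo j) - proj a Bo ((Icc (-a) a).indicator (fo j)))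
              (chiOdd a ((i : ℕ) + 1))).im / Real.sqrt 2))
          + (∑ j : Fin ro, ∑ j' : Fin ro, β j * β j' *
            (weilWindowSesq a ((Icc (-a) a).indicator (fo j) - proj a Bo ((Icc (-a) a).indicator (fo j)))
              ((Icc (-a) a).indicator (fo j') - proj a Bo ((Icc (-a) a).indicator (fo j')))).re))
        - Uqo x β
        + ((2 * ∑ j, Λo x β j *
            ((β j - ∑ j', (∑' n : ℕ, if Bo ≤ n then
                (2 * (Yoshida1992.fourierCoeff a ((n : ℤ) + 1) ((Icc (-a) a).indicator (fo j))).im / Real.sqrt (2 * a)) *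
                (2 * (Yoshida1992.fourierCoeff a ((n : ℤ) + 1) ((Icc (-a) a).indicator (fo j'))).im / Real.sqrt (2 * a))
                else 0) * β j')
            + (∑ i : Fin Bo, (∑' m : ℕ, if Bo ≤ m then
                (2 * (Yoshida1992.fourierCoeff a ((m : ℤ) + 1) ((Icc (-a) a).indicator (fo j))).im / Real.sqrt (2 * a)) *
                ((gramCoeff a (((i : ℕ) : ℤ) + 1) ((m : ℤ) + 1) - gramCoeff a (((i : ℕ) : ℤ) + 1) (-((m : ℤ) + 1))) / 2)
                / dod m else 0) * x i
              + ∑ j'', (∑' m : ℕ, if Bo ≤ m then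
                (2 * (Yoshida1992.fourierCoeff a ((m : ℤ) + 1) ((Icc (-a) a).indicator (fo j))).im / Real.sqrt (2 * a)) *
                ((weilWindowSesq a ((Icc (-a) a).indicator (fo j'') - proj a Bo ((Icc (-a) a).indicator (fo j'')))
                  (chiOdd a (m + 1))).im / Real.sqrt 2) / dod m else 0) * β j'')))
          - ∑ j, ∑ j', Λo x β j * Λo x β j' *
            (∑' m : ℕ, if Bo ≤ m then
              (2 * (Yoshida1992.fourierCoeff a ((m : ℤ) + 1) ((Icc (-a) a).indicator (fo j))).im / Real.sqrt (2 * a)) *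
              (2 * (Yoshida1992.fourierCoeff a ((m : ℤ) + 1) ((Icc (-a) a).indicator (fo j'))).im / Real.sqrt (2 * a))
              / dod m else 0))) :
    WeilPositivityOn a :=
  weilPositivityOn_of_sector_kernels_nonneg ha (gramCoeff a) (weilWindowSesq_chi ha) (gramCoeff_neg_neg a)
    (fun K y ↦ evenKernel_nonneg_of_certificate_cinf ha Be fe hfeC hfee hfer hfe1 de hde₀ hde hfare Λe hlame hΛe Uqe hUqe
      hδe hSe K y)
    (fun K z ↦ oddKernel_nonneg_of_certificate_cinf ha hBo fo hfoC hfoo hfor hfoa hfo1 dod hdo₀ hdo hfaro Λo hlamo hΛo Uqo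
      hUqo hδo hSo K z)

end Summit.RiemannHypothesis.RiemannHypothesis.Theorems.WeilFormatC

end
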